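import Literature.Probability.RandomPlanarGeometry.BDGS2012GrahamCritical
import Literature.Barriers.CriticalPhenomena.LaceExpansionMeanFieldThm23
import Mathlib.Analysis.Normed.Group.Tannery
import HarnessLib

/-!
# Graham's Borel-type bound for `z_c(d)` (BDGS 2012, (1.20)), IX: the critical-point identity
# `2d·z_c = 1 + Σ_a Σ_N (-1)^{N+1} π̂_a^{(N)} z_c^a` (Graham 2010, §3, eq. (identity) at `τ = ∞`)

Sibling file of `Literature.Probability.RandomPlanarGeometry.BDGS2012` (fact
`BDGS2012_Graham_criticalPoint_bound` = Graham 2010, Theorem 1), sequel to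
`BDGS2012GrahamCritical.lean` (the type-`N` bounds on `[0, z_c]`).

## What the source prints

Graham 2010, §3: "The starting point in our analysis will be [HS95]. Let `β_τ = 1/μ_τ`, and take
`β_∞ = β_c`. When `d` is sufficiently large, for `τ` finite and infinite, (identity)
`β_τ = s(1 - Π̂_{β_τ}(0;τ))`" with `Π̂_β(k;τ) = Σ_N (-1)^N Π̂^{(N)}_β(k;τ)`. Slade 2006, §5.2 (proof of
Theorem 5.8): "`χ(z) = Ĝ_z(0) = 1/(1 - z|Ω| - Π̂_z(0))`" for `z < z_c` ((3.30) at `k = 0`), and BDGS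
2012, §5.4: "`1 - z_c|Ω| - Π̂_{z_c}(0) = 0`".

## What is formalised (namespace `Literature.Probability.RandomPlanarGeometry.SAW.Zd.Graham2010`)

With `T_N(a) = diagTotal d a (N-1) = Σ_x π_a^{(N)}(x)` (first-hitting-time lace graphs):
* `sgnTotal d a = Σ_{M<a} (-1)^M diagTotal d a M = Σ_N (-1)^{N+1} T_N(a) = -Σ_x π_a(x)`
  (`tsum_laceCoeff_eq`), `absTotal d a = Σ_{M<a} diagTotal d a M`, and for large `d` and
  `z ∈ [0, z_c]` the summability `summable_absTotal` (from `exists_sum_diagTotal_le`);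
* `piHat d z = Σ_a sgnTotal d a · z^a` (`= -Σ_x Π_z(x) = -Π̂_z(0)`), `tsum_lacePi_eq_neg_piHat`;
* **`susceptibility_mul_eq_one`** — for large `d` and `0 < z < z_c`:
  `χ(z) · (1 - 2dz + piHat d z) = 1` (Slade's (3.30) at `k = 0`, via the tree's
  `latticeFT_twoPoint_mul_eq_one`);
* **`two_mul_natCast_mul_criticalPoint_eq`** — for large `d`:
  `2d · z_c(d) = 1 + piHat d (z_c d)`, i.e. Graham's (identity) at `τ = ∞`
  (`χ(z) ≥ z_c/(z_c - z) → ∞` by `Slade2006_thm23_holds`, and left-continuity of `piHat` at `z_c`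
  by dominated convergence).
-/

noncomputable section

open Finset Filter Topology
open scoped BigOperators ENNReal
open Literature.Probability.LatticeModels Literature.Probability.LatticeModels.SRW
open Literature.Barriers.CriticalPhenomena Literature.Barriers.CriticalPhenomena.SAWLace
open Literature.Probability.RandomPlanarGeometry.LaceExpansion (laceCoeff lacePi laceCoeff_eq_zero_of_notMem_box)

namespace Literature.Probability.RandomPlanarGeometry.SAW.Zd.Graham2010

variable {d : ℕ}

/-! ### The signed and absolute type sums of a fixed length -/

/-- `Σ_N (-1)^{N+1} T_N(a) = Σ_{M<a} (-1)^M diagTotal d a M` (Graham's `Σ_b c_{a,b} s^{b-a}`;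
`= -Σ_x π_a(x)` by `tsum_laceCoeff_eq`). [cite: Graham2010, Section 3, eq. (cab)] -/
def sgnTotal (d a : ℕ) : ℝ := ∑ M ∈ Finset.range a, (-1 : ℝ) ^ M * (diagTotal d a M : ℝ)

/-- `Σ_N T_N(a) = Σ_{M<a} diagTotal d a M`. [cite: Graham2010, Section 3] -/
def absTotal (d a : ℕ) : ℝ := ∑ M ∈ Finset.range a, (diagTotal d a M : ℝ)

/-- `|sgnTotal| ≤ absTotal`. [folklore] -/
theorem abs_sgnTotal_le (d a : ℕ) : |sgnTotal d a| ≤ absTotal d a := by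
  unfold sgnTotal absTotal
  refine (Finset.abs_sum_le_sum_abs _ _).trans (le_of_eq (Finset.sum_congr rfl fun M _ => ?_))
  rw [abs_mul, abs_pow, abs_neg, abs_one, one_pow, one_mul, Nat.abs_cast]

/-- `0 ≤ absTotal`. [folklore] -/
theorem absTotal_nonneg (d a : ℕ) : 0 ≤ absTotal d a := Finset.sum_nonneg fun _ _ => Nat.cast_nonneg _

/-- `diagTotal d a M = 0` for `M ≥ a` (a lace graph of order `M + 1` has length `≥ M + 2`). [folklore] -/
theorem diagTotal_eq_zero_of_le {a M : ℕ} (h : a ≤ M) : diagTotal d a M = 0 := by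
  classical
  unfold diagTotal
  rw [Finset.card_eq_zero, Finset.filter_eq_empty_iff]
  rintro σ - ⟨hD, hT⟩
  have := hD.add_two_le
  omega

/-- `-Σ_x π_a(x) = sgnTotal d a`: the canonical lace coefficient summed over `ℤ^d`, through the
first-hitting-time decomposition `piSigned = Σ_M (-1)^{M+1} piN` (`piSigned_eq_laceCoeff`).
[cite: Slade2006LaceExpansion, eq. (3.25)] -/
theorem tsum_laceCoeff_eq (a : ℕ) : ∑' x : Site d, laceCoeff d 1 a x = -sgnTotal d a := by
  rw [tsum_eq_sum (s := box d a) fun x hx => laceCoeff_eq_zero_of_notMem_box 1 hx]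
  simp_rw [← piSigned_eq_laceCoeff, piSigned]
  push_cast
  rw [Finset.sum_comm, sgnTotal, ← Finset.sum_neg_distrib]
  refine Finset.sum_congr rfl fun M _ => ?_
  rw [diagTotal_eq_sum_piN, Nat.cast_sum, Finset.mul_sum, ← Finset.sum_neg_distrib]
  refine Finset.sum_congr rfl fun x _ => ?_
  rw [pow_succ]; ring

/-! ### Summability on `[0, z_c]` in high dimensions -/

/-- The high-dimensional regime: `d` large enough for `exists_sum_diagTotal_le` with `c₀/d ≤ 1/2`.
[cite: Graham2010, Section 5, eq. (C_HS)] -/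
theorem eventually_goodDim :
    ∃ c₀ : ℝ, 0 < c₀ ∧ ∀ᶠ d : ℕ in atTop, c₀ / d ≤ 1 / 2 ∧ 1 ≤ d ∧
      ∀ (M A : ℕ) (z : ℝ), 0 ≤ z → z ≤ criticalPoint d →
        ∑ a ∈ Finset.range (A + 1), (diagTotal d a M : ℝ) * z ^ a ≤ (c₀ / d) ^ (M + 1) := by
  obtain ⟨c₀, hc₀, h⟩ := exists_sum_diagTotal_le
  refine ⟨c₀, hc₀, ?_⟩
  have hev : ∀ᶠ d : ℕ in atTop, c₀ / d ≤ 1 / 2 := by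
    have : Tendsto (fun d : ℕ => c₀ / d) atTop (𝓝 0) := tendsto_const_nhds.div_atTop tendsto_natCast_atTop_atTop
    exact (this.eventually (Iic_mem_nhds (by norm_num : (0 : ℝ) < 1 / 2))).mono fun d hd => hd
  filter_upwards [h, hev, eventually_ge_atTop 1] with d hd hd2 hd1
  exact ⟨hd2, hd1, hd⟩

/-- Bounded partial sums: `Σ_{a ≤ A} absTotal d a · z^a ≤ 2 c₀/d` in the good regime. [folklore] -/
theorem sum_absTotal_le {c₀ : ℝ} (hc₀ : 0 < c₀) (hr : c₀ / d ≤ 1 / 2)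
    (h : ∀ (M A : ℕ) (z : ℝ), 0 ≤ z → z ≤ criticalPoint d →
      ∑ a ∈ Finset.range (A + 1), (diagTotal d a M : ℝ) * z ^ a ≤ (c₀ / d) ^ (M + 1))
    {z : ℝ} (hz0 : 0 ≤ z) (hzc : z ≤ criticalPoint d) (A : ℕ) :
    ∑ a ∈ Finset.range (A + 1), absTotal d a * z ^ a ≤ 2 * (c₀ / d) := by
  set r := c₀ / d with hr'
  have hr0 : 0 ≤ r := by rw [hr']; positivity
  calc ∑ a ∈ Finset.range (A + 1), absTotal d a * z ^ a
      = ∑ a ∈ Finset.range (A + 1), ∑ M ∈ Finset.range (A + 1), (diagTotal d a M : ℝ) * z ^ a := by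
        refine Finset.sum_congr rfl fun a ha => ?_
        rw [Finset.mem_range] at ha
        rw [absTotal, Finset.sum_mul]
        refine Finset.sum_subset (Finset.range_subset_range.2 (by omega)) fun M hM hM' => ?_
        rw [Finset.mem_range] at hM hM'
        rw [diagTotal_eq_zero_of_le (by omega)]; simp
    _ = ∑ M ∈ Finset.range (A + 1), ∑ a ∈ Finset.range (A + 1), (diagTotal d a M : ℝ) * z ^ a := Finset.sum_comm
    _ ≤ ∑ M ∈ Finset.range (A + 1), r ^ (M + 1) := Finset.sum_le_sum fun M _ => h M A z hz0 hzc
    _ = r * ∑ M ∈ Finset.range (A + 1), r ^ M := by rw [Finset.mul_sum]; exact Finset.sum_congr rfl fun M _ => by ring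
    _ ≤ r * 2 := by
        refine mul_le_mul_of_nonneg_left ?_ hr0
        have hgeom := geom_sum_eq (x := r) (by linarith : r ≠ 1) (A + 1)
        rw [hgeom]
        have h1 : r ^ (A + 1) ≤ 1 := pow_le_one₀ hr0 (by linarith)
        have h2 : 0 ≤ r ^ (A + 1) := by positivity
        rw [div_le_iff_of_neg (by linarith)]
        nlinarith
    _ = 2 * (c₀ / d) := by ring

/-- Summability of `Σ_a absTotal d a · z^a` on `[0, z_c]` in the good regime, with the bound
`≤ 2c₀/d` on the sum. [folklore] -/
theorem summable_absTotal {c₀ : ℝ} (hc₀ : 0 < c₀) (hr : c₀ / d ≤ 1 / 2)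
    (h : ∀ (M A : ℕ) (z : ℝ), 0 ≤ z → z ≤ criticalPoint d →
      ∑ a ∈ Finset.range (A + 1), (diagTotal d a M : ℝ) * z ^ a ≤ (c₀ / d) ^ (M + 1))
    {z : ℝ} (hz0 : 0 ≤ z) (hzc : z ≤ criticalPoint d) :
    Summable (fun a => absTotal d a * z ^ a) ∧ ∑' a, absTotal d a * z ^ a ≤ 2 * (c₀ / d) := by
  have hnn : ∀ a, 0 ≤ absTotal d a * z ^ a := fun a => mul_nonneg (absTotal_nonneg d a) (pow_nonneg hz0 a)
  have hbdd : ∀ A, ∑ a ∈ Finset.range A, absTotal d a * z ^ a ≤ 2 * (c₀ / d) := by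
    intro A
    rcases A with _ | A
    · simp; positivity
    · exact sum_absTotal_le hc₀ hr h hz0 hzc A
  have hs : Summable fun a => absTotal d a * z ^ a := summable_of_sum_range_le hnn hbdd
  exact ⟨hs, hs.tsum_le_of_sum_range_le hbdd⟩

/-! ### `Π̂_z(0)` as a power series in the length -/

/-- `piHat d z = Σ_a sgnTotal d a · z^a = -Σ_x Π_z(x) = -Π̂_z(0)` (Graham's `Σ_{(a,b)∈I} β^a c_{a,b} s^{b-a}`
at `β = z`). [cite: Graham2010, Section 3, eq. (iterative_formula)] -/
def piHat (d : ℕ) (z : ℝ) : ℝ := ∑' a : ℕ, sgnTotal d a * z ^ a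

/-- `Σ_M Σ_x Π_z^{(M+1)}(x) < ∞` in the good regime (so the tree's summability hypothesis of (3.27)/(3.30)
holds). [cite: Slade2006LaceExpansion, §5.2 (eq. (5.46) summed)] -/
theorem tsum_tsum_piGen_ne_top {c₀ : ℝ} (hc₀ : 0 < c₀) (hr : c₀ / d ≤ 1 / 2)
    (h : ∀ (M A : ℕ) (z : ℝ), 0 ≤ z → z ≤ criticalPoint d →
      ∑ a ∈ Finset.range (A + 1), (diagTotal d a M : ℝ) * z ^ a ≤ (c₀ / d) ^ (M + 1))
    {z : ℝ} (hz0 : 0 ≤ z) (hzc : z ≤ criticalPoint d) :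
    ∑' M : ℕ, ∑' x : Site d, piGen d z M x ≠ ∞ := by
  set r := c₀ / d with hr'
  have hr0 : 0 ≤ r := by rw [hr']; positivity
  have hM : ∀ M, ∑' x : Site d, piGen d z M x ≤ ENNReal.ofReal (r ^ (M + 1)) := by
    intro M
    rw [tsum_piGen_eq]
    refine ENNReal.tsum_le_of_sum_range_le fun A => ?_
    rcases A with _ | A
    · simp
    have heq : ∑ a ∈ Finset.range (A + 1), (diagTotal d a M : ℝ≥0∞) * ENNReal.ofReal z ^ a =
        ENNReal.ofReal (∑ a ∈ Finset.range (A + 1), (diagTotal d a M : ℝ) * z ^ a) := by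
      rw [ENNReal.ofReal_sum_of_nonneg fun a _ => by positivity]
      refine Finset.sum_congr rfl fun a _ => ?_
      rw [ENNReal.ofReal_mul (by positivity), ENNReal.ofReal_natCast, ENNReal.ofReal_pow hz0]
    rw [heq]
    exact ENNReal.ofReal_le_ofReal (h M A z hz0 hzc)
  refine ne_top_of_le_ne_top (b := ∑' M : ℕ, ENNReal.ofReal (r ^ (M + 1))) ?_ (ENNReal.tsum_le_tsum hM)
  rw [← ENNReal.ofReal_tsum_of_nonneg (fun M => by positivity)]
  · exact ENNReal.ofReal_ne_top
  · simp_rw [pow_succ]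
    exact (summable_geometric_of_lt_one hr0 (by linarith)).mul_right r

/-- `Σ_x Π_z(x) = -piHat d z` for `0 ≤ z ≤ z_c` in the good regime (absolute convergence of the
double series in `(m, x)`, then `tsum_laceCoeff_eq`). [cite: Slade2006LaceExpansion, eq. (3.28)] -/
theorem tsum_lacePi_eq_neg_piHat {c₀ : ℝ} (hc₀ : 0 < c₀) (hr : c₀ / d ≤ 1 / 2)
    (h : ∀ (M A : ℕ) (z : ℝ), 0 ≤ z → z ≤ criticalPoint d →
      ∑ a ∈ Finset.range (A + 1), (diagTotal d a M : ℝ) * z ^ a ≤ (c₀ / d) ^ (M + 1))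
    {z : ℝ} (hz0 : 0 ≤ z) (hzc : z ≤ criticalPoint d) :
    (Summable fun p : ℕ × Site d => |laceCoeff d 1 p.1 p.2| * z ^ p.1) ∧
      ∑' x : Site d, lacePi d 1 z x = -piHat d z := by
  have hsum : Summable fun p : ℕ × Site d => |laceCoeff d 1 p.1 p.2| * z ^ p.1 :=
    summable_abs_laceCoeff_of_ne_top hz0 (tsum_tsum_piGen_ne_top hc₀ hr h hz0 hzc)
  refine ⟨hsum, ?_⟩
  have hsum' : Summable fun p : ℕ × Site d => laceCoeff d 1 p.1 p.2 * z ^ p.1 := by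
    refine hsum.of_norm_bounded fun p => ?_
    rw [Real.norm_eq_abs, abs_mul, abs_pow, abs_of_nonneg hz0]
  -- swap the sums
  have hswap : ∑' x : Site d, lacePi d 1 z x = ∑' m : ℕ, ∑' x : Site d, laceCoeff d 1 m x * z ^ m := by
    unfold lacePi
    exact Summable.tsum_comm (f := fun m x => laceCoeff d 1 m x * z ^ m) hsum'
  rw [hswap, piHat, ← tsum_neg]
  refine tsum_congr fun m => ?_
  rw [tsum_mul_right, tsum_laceCoeff_eq]; ring

/-! ### The identity below and at the critical point -/

/-- The lattice Fourier transform at `k = 0` is the plain sum. [folklore] -/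
theorem latticeFT_zero (f : Site d → ℝ) : latticeFT f 0 = ((∑' x : Site d, f x : ℝ) : ℂ) := by
  unfold latticeFT
  rw [Complex.ofReal_tsum]
  refine tsum_congr fun x => ?_
  simp

/-- **(3.30) at `k = 0`**: for `0 < z < z_c` in the good regime, `χ(z) · (1 - 2dz + piHat d z) = 1`
(Slade: "`χ(z) = Ĝ_z(0) = 1/(1 - z|Ω| - Π̂_z(0))`"). [cite: Slade2006LaceExpansion, eq. (3.30) and (5.30)] -/
theorem susceptibility_mul_eq_one {c₀ : ℝ} (hc₀ : 0 < c₀) (hr : c₀ / d ≤ 1 / 2)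
    (h : ∀ (M A : ℕ) (z : ℝ), 0 ≤ z → z ≤ criticalPoint d →
      ∑ a ∈ Finset.range (A + 1), (diagTotal d a M : ℝ) * z ^ a ≤ (c₀ / d) ^ (M + 1))
    {z : ℝ} (hz : 0 < z) (hzc : z < criticalPoint d) :
    susceptibility d 1 z * (1 - 2 * d * z + piHat d z) = 1 := by
  obtain ⟨hπ, hlace⟩ := tsum_lacePi_eq_neg_piHat hc₀ hr h hz.le hzc.le
  have hid := latticeFT_twoPoint_mul_eq_one hz hzc hπ 0
  rw [latticeFT_zero, latticeFT_zero, hlace, (hasSum_twoPoint hz.le hzc).tsum_eq] at hid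
  have hcos : (2 * ∑ j : Fin d, Real.cos ((0 : Fin d → ℝ) j) : ℝ) = 2 * d := by
    simp
  rw [hcos] at hid
  have hid' : ((susceptibility d 1 z * (1 - 2 * d * z + piHat d z) : ℝ) : ℂ) = (1 : ℂ) := by
    rw [← hid]; push_cast; ring
  exact_mod_cast hid'

/-- Left-continuity of `piHat` at `z_c` (dominated convergence against `Σ_a absTotal d a · z_c^a`).
[folklore] -/
theorem tendsto_piHat {c₀ : ℝ} (hc₀ : 0 < c₀) (hr : c₀ / d ≤ 1 / 2) (hd : 1 ≤ d)
    (h : ∀ (M A : ℕ) (z : ℝ), 0 ≤ z → z ≤ criticalPoint d →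
      ∑ a ∈ Finset.range (A + 1), (diagTotal d a M : ℝ) * z ^ a ≤ (c₀ / d) ^ (M + 1)) :
    Tendsto (piHat d) (𝓝[<] criticalPoint d) (𝓝 (piHat d (criticalPoint d))) := by
  haveI : NeZero d := ⟨by omega⟩
  have hzc0 : 0 < criticalPoint d := criticalPoint_pos d
  obtain ⟨hsum, -⟩ := summable_absTotal hc₀ hr h hzc0.le le_rfl
  unfold piHat
  refine tendsto_tsum_of_dominated_convergence hsum (fun a => ?_) ?_
  · exact ((continuous_const.mul (continuous_pow a)).tendsto _).mono_left nhdsWithin_le_nhds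
  · have : Set.Ioo 0 (criticalPoint d) ∈ 𝓝[<] criticalPoint d := Ioo_mem_nhdsLT hzc0
    filter_upwards [this] with w hw a
    rw [Real.norm_eq_abs, abs_mul, abs_pow, abs_of_pos hw.1]
    exact mul_le_mul (abs_sgnTotal_le d a) (pow_le_pow_left₀ hw.1.le hw.2.le a) (pow_nonneg hw.1.le a)
      (absTotal_nonneg d a)

/-- **Graham's (identity) at `τ = ∞`** (equivalently BDGS's "`1 - z_c|Ω| - Π̂_{z_c}(0) = 0`"): in the
good regime, `2d · z_c(d) = 1 + piHat d (z_c(d))`, i.e.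
`2d·z_c = 1 + Σ_a Σ_N (-1)^{N+1} (Σ_x π_a^{(N)}(x)) z_c^a`. [cite: Graham2010, Section 3, eq. (identity)] -/
theorem two_mul_natCast_mul_criticalPoint_eq {c₀ : ℝ} (hc₀ : 0 < c₀) (hr : c₀ / d ≤ 1 / 2) (hd : 1 ≤ d)
    (h : ∀ (M A : ℕ) (z : ℝ), 0 ≤ z → z ≤ criticalPoint d →
      ∑ a ∈ Finset.range (A + 1), (diagTotal d a M : ℝ) * z ^ a ≤ (c₀ / d) ^ (M + 1)) :
    2 * (d : ℝ) * criticalPoint d = 1 + piHat d (criticalPoint d) := by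
  haveI : NeZero d := ⟨by omega⟩
  have hzc0 : 0 < criticalPoint d := criticalPoint_pos d
  set φ : ℝ → ℝ := fun z => 1 - 2 * d * z + piHat d z with hφ
  -- `φ → φ(z_c)` along `z ↑ z_c`
  have h1 : Tendsto φ (𝓝[<] criticalPoint d) (𝓝 (φ (criticalPoint d))) := by
    have hlin : Tendsto (fun z : ℝ => 1 - 2 * d * z) (𝓝[<] criticalPoint d) (𝓝 (1 - 2 * d * criticalPoint d)) :=
      ((continuous_const.sub (continuous_const.mul continuous_id)).tendsto _).mono_left nhdsWithin_le_nhds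
    exact hlin.add (tendsto_piHat hc₀ hr hd h)
  -- `φ → 0` along `z ↑ z_c`: `0 < φ(z) = 1/χ(z) ≤ (z_c - z)/z_c`
  have h2 : Tendsto φ (𝓝[<] criticalPoint d) (𝓝 0) := by
    have hup : Tendsto (fun z : ℝ => (criticalPoint d - z) / criticalPoint d) (𝓝[<] criticalPoint d) (𝓝 0) := by
      have : Tendsto (fun z : ℝ => (criticalPoint d - z) / criticalPoint d) (𝓝 (criticalPoint d))
          (𝓝 ((criticalPoint d - criticalPoint d) / criticalPoint d)) :=
        ((continuous_const.sub continuous_id).div_const _).tendsto _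
      rw [sub_self, zero_div] at this
      exact this.mono_left nhdsWithin_le_nhds
    refine tendsto_of_tendsto_of_tendsto_of_le_of_le' tendsto_const_nhds hup ?_ ?_
    · have : Set.Ioo 0 (criticalPoint d) ∈ 𝓝[<] criticalPoint d := Ioo_mem_nhdsLT hzc0
      filter_upwards [this] with z hz
      have hχ := susceptibility_mul_eq_one hc₀ hr h hz.1 hz.2
      have hχpos : 0 < susceptibility d 1 z :=
        lt_of_lt_of_le (div_pos hzc0 (by linarith [hz.2])) (Slade2006_thm23_holds d hd z hz.1 hz.2).1
      have : φ z = (susceptibility d 1 z)⁻¹ := by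
        rw [hφ]; exact (eq_inv_of_mul_eq_one_right hχ)
      rw [this]; positivity
    · have : Set.Ioo 0 (criticalPoint d) ∈ 𝓝[<] criticalPoint d := Ioo_mem_nhdsLT hzc0
      filter_upwards [this] with z hz
      have hχ := susceptibility_mul_eq_one hc₀ hr h hz.1 hz.2
      have hlow := (Slade2006_thm23_holds d hd z hz.1 hz.2).1
      have hpos : 0 < criticalPoint d / (criticalPoint d - z) := div_pos hzc0 (by linarith [hz.2])
      have : φ z = (susceptibility d 1 z)⁻¹ := by
        rw [hφ]; exact (eq_inv_of_mul_eq_one_right hχ)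
      rw [this]
      calc (susceptibility d 1 z)⁻¹ ≤ (criticalPoint d / (criticalPoint d - z))⁻¹ := by
            exact inv_anti₀ hpos hlow
        _ = (criticalPoint d - z) / criticalPoint d := by rw [inv_div]
  have heq : φ (criticalPoint d) = 0 := tendsto_nhds_unique h1 h2
  rw [hφ] at heq
  simp only at heq
  linarith

end Literature.Probability.RandomPlanarGeometry.SAW.Zd.Graham2010
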